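import Mathlib.RingTheory.Unramified.Finite
import Mathlib.FieldTheory.Minpoly.Field
import Mathlib.Algebra.MvPolynomial.PDeriv
import Mathlib.LinearAlgebra.Matrix.Adjugate
import Mathlib.RingTheory.MvPolynomial.Basic
import HarnessLib

/-!
# A square polynomial system has finitely many nonsingular zeros

Topic `Literature/ModelTheory/PseudofiniteFields` (used by the dimension theory of definable sets
over pseudo-finite fields: a standard smooth locus of codimension `m` in `K^m` is finite, and so
are the fibres of a standard smooth locus over its free coordinates).

**Theorem** (`finite_nonsingular_zeros`).  Let `K` be a field and
`g_1, …, g_c ∈ K[X_1, …, X_c]`.  Then the set of NONSINGULAR zeros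
`{z ∈ K^c | g(z) = 0, det (∂g_i/∂X_j)(z) ≠ 0}` is finite.

This is the elementary case "an unramified algebra essentially of finite type over a field is
finite, hence has finitely many `K`-points" of the structure theory of unramified algebras
[Iversen1973, Prop. I.2.8; StacksProject, §10.151 "Unramified ring maps"].  PROOF (as
formalised): the nonsingular zeros are `K`-points of `R = K[X_1..X_c, W]/(g_1, …, g_c, W·Δ − 1)`,
`Δ = det (∂g_i/∂X_j)`; in `Ω[R/K]` the relations `d g_i = Σ_j (∂_j g_i) dX_j = 0` and the
adjugate identity give `Δ · dX_j = 0`, and `Δ` is a unit of `R`, so `dX_j = 0`, `dW = 0`, hence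
`Ω[R/K] = 0` (chain rule `Derivation.map_mvPolynomial_aeval`); so `R` is formally unramified,
hence a FINITE `K`-algebra by Mathlib's `Algebra.FormallyUnramified.finite_of_free`
(Iversen I.2.8), and a finite algebra over a field has finitely many `K`-algebra maps to `K`
(`minpoly.AlgHom.fintype`), into which the nonsingular zeros inject by evaluation.

## References

* [Iversen1973] B. Iversen, Generic Local Structure of the Morphisms in Commutative Algebra,
  Lecture Notes in Math. 310, Springer 1973, Prop. I.2.8 (unramified + free ⇒ finite).
* [StacksProject] The Stacks Project, §10.151 (unramified ring maps), §10.143 (étale ring maps).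
-/

namespace Literature.ModelTheory.PseudofiniteFields

open MvPolynomial

section ChainRule

variable {R A M : Type*} [CommRing R] [CommRing A] [Algebra R A] [AddCommGroup M] [Module A M]
  [Module R M]

/-- **Chain rule for derivations along polynomial maps**: for an `R`-derivation `D` of `A`, a
tuple `a ∈ A^σ` and `p ∈ R[X_σ]`, `D(p(a)) = Σ_i (∂_i p)(a) · D(a_i)`. [folklore] -/
theorem Derivation.map_mvPolynomial_aeval {σ : Type*} [Fintype σ] [DecidableEq σ]
    (D : Derivation R A M) (a : σ → A) (p : MvPolynomial σ R) :
    D (aeval a p) = ∑ i, aeval a (pderiv i p) • D (a i) := by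
  induction p using MvPolynomial.induction_on with
  | C r => simp
  | add p q hp hq =>
    simp only [map_add, hp, hq, add_smul, Finset.sum_add_distrib]
  | mul_X p s hp =>
    have hX : ∀ i : σ, aeval a (pderiv i (X s : MvPolynomial σ R)) = if s = i then (1 : A) else 0 := by
      intro i
      rw [pderiv_X, Pi.single_apply]
      split_ifs <;> simp
    have hR : ∀ i, aeval a (pderiv i (p * X s)) • D (a i) =
        (a s * aeval a (pderiv i p)) • D (a i) + (if s = i then aeval a p • D (a i) else 0) := by
      intro i
      rw [Derivation.leibniz, map_add, smul_eq_mul, smul_eq_mul, map_mul, map_mul, aeval_X, hX,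
        add_smul, add_comm]
      congr 1
      split_ifs <;> simp
    rw [map_mul, aeval_X, Derivation.leibniz, hp]
    simp_rw [hR, Finset.sum_add_distrib, Finset.sum_ite_eq, Finset.mem_univ, if_true]
    rw [add_comm, Finset.smul_sum]
    congr 1
    refine Finset.sum_congr rfl fun i _ => ?_
    rw [smul_smul]

end ChainRule

section Adjugate

variable {A M : Type*} [CommRing A] [AddCommGroup M] [Module A M] {n : Type*} [Fintype n]
  [DecidableEq n]

/-- **Cramer / adjugate for module-valued vectors**: if `Σ_j J_{ij} · v_j = 0` for all `i`, then
`det J · v_k = 0` for all `k`. [folklore] -/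
theorem det_smul_eq_zero_of_forall_sum_smul_eq_zero (J : Matrix n n A) (v : n → M)
    (h : ∀ i, ∑ j, J i j • v j = 0) (k : n) : J.det • v k = 0 := by
  have hk : ∑ j, (J.adjugate * J) k j • v j = J.det • v k := by
    rw [Matrix.adjugate_mul, Finset.sum_eq_single k]
    · simp
    · intro j _ hjk
      rw [Matrix.smul_apply, Matrix.one_apply_ne (Ne.symm hjk), smul_zero, zero_smul]
    · intro hk; exact absurd (Finset.mem_univ k) hk
  rw [← hk]
  calc ∑ j, (J.adjugate * J) k j • v j
      = ∑ j, ∑ i, (J.adjugate k i * J i j) • v j := by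
        refine Finset.sum_congr rfl fun j _ => ?_
        rw [Matrix.mul_apply, Finset.sum_smul]
    _ = ∑ i, J.adjugate k i • ∑ j, J i j • v j := by
        rw [Finset.sum_comm]
        refine Finset.sum_congr rfl fun i _ => ?_
        rw [Finset.smul_sum]
        refine Finset.sum_congr rfl fun j _ => ?_
        rw [smul_smul]
    _ = 0 := by simp [h]

end Adjugate

section Main

variable {K : Type*} [Field K] {c : ℕ}

/-- **A square polynomial system over a field has finitely many nonsingular zeros**: for
`g_1, …, g_c ∈ K[X_1, …, X_c]` the set `{z ∈ K^c | g(z) = 0 ∧ det(∂g_i/∂X_j)(z) ≠ 0}` is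
finite.  (The coordinate ring of the nonsingular locus, `K[X, W]/(g, W·Δ − 1)`, has
`Ω = 0`, hence is unramified, hence finite over `K`, hence has finitely many `K`-points.)
[cite: Iversen1973, Prop. I.2.8] -/
theorem finite_nonsingular_zeros (g : Fin c → MvPolynomial (Fin c) K) :
    {z : Fin c → K | (∀ i, eval z (g i) = 0) ∧
      eval z (Matrix.of fun i j : Fin c => pderiv j (g i)).det ≠ 0}.Finite := by
  classical
  -- the Jacobian determinant and the presentation `P/I` of the nonsingular locus
  set Δ : MvPolynomial (Fin c) K := (Matrix.of fun i j : Fin c => pderiv j (g i)).det with hΔ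
  set ι : MvPolynomial (Fin c) K →ₐ[K] MvPolynomial (Fin c ⊕ Unit) K := rename Sum.inl with hι
  set I : Ideal (MvPolynomial (Fin c ⊕ Unit) K) :=
    Ideal.span (insert (X (Sum.inr ()) * ι Δ - 1) (Set.range fun i => ι (g i))) with hI
  -- generators of `R = P/I`
  set xb : Fin c → MvPolynomial (Fin c ⊕ Unit) K ⧸ I :=
    fun i => Ideal.Quotient.mk I (X (Sum.inl i)) with hxb
  set wb : MvPolynomial (Fin c ⊕ Unit) K ⧸ I := Ideal.Quotient.mk I (X (Sum.inr ())) with hwb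
  -- the quotient map is evaluation at the generators
  have hmkP : ∀ p : MvPolynomial (Fin c ⊕ Unit) K,
      Ideal.Quotient.mk I p = aeval (Sum.elim xb fun _ => wb) p := by
    have hcomp : Ideal.Quotient.mkₐ K I = aeval (Sum.elim xb fun _ => wb) :=
      MvPolynomial.algHom_ext fun v => by
        rcases v with i | u
        · rw [aeval_X, Sum.elim_inl, hxb]; rfl
        · rw [aeval_X, Sum.elim_inr, hwb]; rfl
    intro p
    exact AlgHom.congr_fun hcomp p
  have hmk : ∀ p : MvPolynomial (Fin c) K, Ideal.Quotient.mk I (ι p) = aeval xb p := by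
    intro p
    rw [hmkP, hι, aeval_rename, Sum.elim_comp_inl]
  have hg : ∀ i, aeval xb (g i) = 0 := by
    intro i
    rw [← hmk, Ideal.Quotient.eq_zero_iff_mem, hI]
    exact Ideal.subset_span (Set.mem_insert_of_mem _ ⟨i, rfl⟩)
  have hw : wb * aeval xb Δ = 1 := by
    rw [← hmk, hwb, ← map_mul, ← (Ideal.Quotient.mk I).map_one, Ideal.Quotient.eq, hI]
    exact Ideal.subset_span (Set.mem_insert _ _)
  have hunit : IsUnit (aeval xb Δ) := IsUnit.of_mul_eq_one wb (by rwa [mul_comm] at hw)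
  -- `Ω[R/K] = 0`: the universal derivation kills the generators
  obtain ⟨D, hD⟩ : ∃ D : Derivation K (MvPolynomial (Fin c ⊕ Unit) K ⧸ I)
      (KaehlerDifferential K (MvPolynomial (Fin c ⊕ Unit) K ⧸ I)),
      D = KaehlerDifferential.D K (MvPolynomial (Fin c ⊕ Unit) K ⧸ I) := ⟨_, rfl⟩
  have hJ : ∀ i, ∑ j, aeval xb (pderiv j (g i)) • D (xb j) = 0 := by
    intro i
    rw [← Derivation.map_mvPolynomial_aeval, hg, map_zero]
  have hdet : (Matrix.of fun i j : Fin c => aeval xb (pderiv j (g i))).det = aeval xb Δ := by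
    rw [hΔ, AlgHom.map_det]
    congr 1
  have hDx : ∀ k, D (xb k) = 0 := by
    intro k
    have h1 := det_smul_eq_zero_of_forall_sum_smul_eq_zero
      (Matrix.of fun i j : Fin c => aeval xb (pderiv j (g i))) (fun j => D (xb j))
      (fun i => by simpa only [Matrix.of_apply] using hJ i) k
    rw [hdet] at h1
    exact hunit.smul_left_cancel.1 (h1.trans (smul_zero _).symm)
  have hDΔ : D (aeval xb Δ) = 0 := by
    rw [Derivation.map_mvPolynomial_aeval]
    simp [hDx]
  have hDw : D wb = 0 := by
    have h1 : D (wb * aeval xb Δ) = 0 := by rw [hw, Derivation.map_one_eq_zero]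
    rw [Derivation.leibniz, hDΔ, smul_zero, zero_add] at h1
    exact hunit.smul_left_cancel.1 (h1.trans (smul_zero _).symm)
  have hDall : ∀ r : MvPolynomial (Fin c ⊕ Unit) K ⧸ I, D r = 0 := by
    intro r
    obtain ⟨p, rfl⟩ := Ideal.Quotient.mk_surjective r
    rw [hmkP, Derivation.map_mvPolynomial_aeval]
    refine Finset.sum_eq_zero fun v _ => ?_
    rcases v with i | u
    · rw [Sum.elim_inl, hDx, smul_zero]
    · rw [Sum.elim_inr, hDw, smul_zero]
  have hΩ : Subsingleton (KaehlerDifferential K (MvPolynomial (Fin c ⊕ Unit) K ⧸ I)) := by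
    have htop : (⊤ : Submodule (MvPolynomial (Fin c ⊕ Unit) K ⧸ I)
        (KaehlerDifferential K (MvPolynomial (Fin c ⊕ Unit) K ⧸ I))) ≤ ⊥ := by
      rw [← KaehlerDifferential.span_range_derivation, ← hD, Submodule.span_le]
      rintro _ ⟨r, rfl⟩
      rw [SetLike.mem_coe, hDall r]
      exact Submodule.zero_mem _
    refine ⟨fun a b => ?_⟩
    have ha : a ∈ (⊥ : Submodule (MvPolynomial (Fin c ⊕ Unit) K ⧸ I)
        (KaehlerDifferential K (MvPolynomial (Fin c ⊕ Unit) K ⧸ I))) := htop Submodule.mem_top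
    have hb : b ∈ (⊥ : Submodule (MvPolynomial (Fin c ⊕ Unit) K ⧸ I)
        (KaehlerDifferential K (MvPolynomial (Fin c ⊕ Unit) K ⧸ I))) := htop Submodule.mem_top
    rw [Submodule.mem_bot] at ha hb
    rw [ha, hb]
  -- unramified, hence finite over `K`, hence finitely many `K`-algebra maps to `K`
  haveI : Algebra.FormallyUnramified K (MvPolynomial (Fin c ⊕ Unit) K ⧸ I) := ⟨hΩ⟩
  haveI : Module.Finite K (MvPolynomial (Fin c ⊕ Unit) K ⧸ I) :=
    Algebra.FormallyUnramified.finite_of_free K _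
  haveI : Fintype ((MvPolynomial (Fin c ⊕ Unit) K ⧸ I) →ₐ[K] K) := minpoly.AlgHom.fintype K _ K
  -- the nonsingular zeros inject into the `K`-points of `R`
  set Z := {z : Fin c → K | (∀ i, eval z (g i) = 0) ∧ eval z Δ ≠ 0} with hZ
  have hker : ∀ z ∈ Z, ∀ a ∈ I, aeval (Sum.elim z fun _ => (eval z Δ)⁻¹) a = 0 := by
    intro z hz
    have hev : ∀ p : MvPolynomial (Fin c) K,
        aeval (Sum.elim z fun _ => (eval z Δ)⁻¹) (ι p) = eval z p := by
      intro p
      rw [hι, aeval_rename, Sum.elim_comp_inl, ← aeval_eq_eval]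
    have hle : I ≤ RingHom.ker (aeval (Sum.elim z fun _ => (eval z Δ)⁻¹) :
        MvPolynomial (Fin c ⊕ Unit) K →ₐ[K] K) := by
      rw [hI, Ideal.span_le]
      rintro a (rfl | ⟨i, rfl⟩)
      · rw [SetLike.mem_coe, RingHom.mem_ker, map_sub, map_mul, map_one, aeval_X, Sum.elim_inr,
          hev, inv_mul_cancel₀ hz.2, sub_self]
      · rw [SetLike.mem_coe, RingHom.mem_ker, hev]
        exact hz.1 i
    intro a ha
    exact RingHom.mem_ker.1 (hle ha)
  let F : Z → ((MvPolynomial (Fin c ⊕ Unit) K ⧸ I) →ₐ[K] K) := fun z =>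
    Ideal.Quotient.liftₐ I (aeval (Sum.elim z.1 fun _ => (eval z.1 Δ)⁻¹)) (hker z.1 z.2)
  have hFx : ∀ (z : Z) (i : Fin c), F z (xb i) = z.1 i := by
    intro z i
    show Ideal.Quotient.liftₐ I _ _ (Ideal.Quotient.mk I (X (Sum.inl i))) = z.1 i
    rw [Ideal.Quotient.liftₐ_apply, Ideal.Quotient.lift_mk]
    simp
  have hF : Function.Injective F := by
    intro z z' hzz'
    apply Subtype.ext
    funext i
    rw [← hFx z i, ← hFx z' i, hzz']
  haveI : Finite Z := Finite.of_injective F hF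
  exact Set.toFinite Z

end Main

end Literature.ModelTheory.PseudofiniteFields
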